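import Mathlib
import HarnessLib
import Summits.ValiantsHypothesis.ValiantsHypothesis.Theorems.MonotoneRestorationOrbitRestorationQPMultiRowColumnProducts

/-!
# Orbit sums of arbitrary COLUMN-SYMMETRIC polynomials of `k` rows, over all maps and over injective maps
# (route MonotoneRestoration, crux `OrbitRestorationQP` stmt-ValiantsHypothesis-18293; certified sub-class of the crux)

Namespace `Summit.ValiantsHypothesis.ValiantsHypothesis.Theorems.MultiRowColumnProducts`.  Definition-free.

`…MultiRowColumnProducts.lean` restored `Σ_g Φ g` for equivariant families with `Φ g ∈ ℂ[P_α(g) : α]` and instantiated it with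
column PRODUCTS of a `k`-row template.  By the first fundamental theorem of multisymmetric functions the hypothesis is just
"`Φ g` is a column-symmetric polynomial in the `k × n` submatrix on the rows `g`", so the natural general instance is an arbitrary
column-symmetric PATTERN `Ψ ∈ ℂ[(Fin n) × (Fin k)]` (invariant under permuting the first coordinate) evaluated at `X (b, i) ↦ x_{g(i) b}`:

* `aeval_mem_adjoin_multiRowPowerSums` — `Ψ(x_{g,·}) ∈ ℂ[P_α(g) : α]` for column-symmetric `Ψ`;
* `qpOrbitRestorable_orbitSum_colSymmetric` — **`Σ_{g : Fin k → Fin n} Ψ(x_{g(i) b})` is `QPOrbitRestorable (2k + 9) n` for every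
  column-symmetric pattern `Ψ`** (e.g. commuting column scans with `k`-row templates, symmetric functions of the `n` column values
  `φ(x_{g,b})`, …);
* `qpOrbitRestorable_orbitSum_injective` — the same summed over INJECTIVE `g : Fin k ↪ Fin n` only (`k` distinct rows), for any
  equivariant family `Φ g ∈ ℂ[P_α(g) : α]`; `qpOrbitRestorable_orbitSum_colSymmetric_injective` — the pattern instance.

Honest label: a stratum of the crux class (matrix-symmetric `VP` families for polynomial-size patterns; outside depth three in
general); no stub closed; VP ≠ VNP untouched. [folklore] [cite: Weyl1939, Chap. II §3, Thm (2.3.A); DawarWilsenach2025, §3.3]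
-/

noncomputable section

open scoped Classical

-- `Summit.ValiantsHypothesis.ValiantsHypothesis.…` is the tree's single-conjunct layout (Sub = Summit).
set_option linter.dupNamespace false

namespace Summit.ValiantsHypothesis.ValiantsHypothesis.Theorems.MultiRowColumnProducts

open MvPolynomial Equiv Literature.Computability.AlgebraicComplexity OrbitRestorationQPDepthThreeRung
  Summit.ValiantsHypothesis.ValiantsHypothesis.Theorems RowColumnTwoLevel

variable {n : ℕ}

/-- **Column-symmetric patterns lie in the multi-row power-sum algebra.**  If `Ψ ∈ ℂ[X_{(b,i)} : b < n, i < k]` is invariant under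
permuting the column index `b`, then `Ψ(x_{g(i) b}) ∈ ℂ[P_α(g) : α]`. [cite: Weyl1939, Chap. II §3, Thm (2.3.A)] -/
theorem aeval_mem_adjoin_multiRowPowerSums {k : ℕ} (g : Fin k → Fin n) (Ψ : MvPolynomial (Fin n × Fin k) ℂ)
    (hΨ : ∀ σ : Perm (Fin n), rename (fun w : Fin n × Fin k => (σ w.1, w.2)) Ψ = Ψ) :
    aeval (fun w : Fin n × Fin k => (X (g w.2, w.1) : MvPolynomial (Fin n × Fin n) ℂ)) Ψ ∈
      Algebra.adjoin ℂ (Set.range fun α : Fin k → ℕ =>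
        ∑ b : Fin n, ∏ i : Fin k, (X (g i, b) : MvPolynomial (Fin n × Fin n) ℂ) ^ α i) := by
  have hmem := MultisymmetricPowerSums.mem_adjoin_powerSums_of_rowSymmetric_complex Ψ hΨ
  set ψ : MvPolynomial (Fin n × Fin k) ℂ →ₐ[ℂ] MvPolynomial (Fin n × Fin n) ℂ :=
    aeval fun w : Fin n × Fin k => (X (g w.2, w.1) : MvPolynomial (Fin n × Fin n) ℂ) with hψ
  have hψgen : ψ '' (Set.range fun α : Fin k → ℕ => ∑ b : Fin n, ∏ i : Fin k, (X (b, i) : MvPolynomial (Fin n × Fin k) ℂ) ^ α i) =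
      Set.range fun α : Fin k → ℕ => ∑ b : Fin n, ∏ i : Fin k, (X (g i, b) : MvPolynomial (Fin n × Fin n) ℂ) ^ α i := by
    rw [← Set.range_comp]
    refine congrArg Set.range (funext fun α => ?_)
    simp only [Function.comp_apply, map_sum, map_prod, map_pow, hψ, aeval_X]
  rw [← hψgen, Algebra.adjoin_image]
  exact Subalgebra.mem_map.mpr ⟨Ψ, hmem, rfl⟩

/-- The evaluated pattern family is equivariant: `ren σ (Ψ(x_{g,·})) = Ψ(x_{σ ∘ g,·})` for column-symmetric `Ψ`. [folklore] -/
theorem ren_aeval_pattern {k : ℕ} (Ψ : MvPolynomial (Fin n × Fin k) ℂ)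
    (hΨ : ∀ σ : Perm (Fin n), rename (fun w : Fin n × Fin k => (σ w.1, w.2)) Ψ = Ψ)
    (σ : Perm (Fin n)) (g : Fin k → Fin n) :
    ren σ (aeval (fun w : Fin n × Fin k => (X (g w.2, w.1) : MvPolynomial (Fin n × Fin n) ℂ)) Ψ) =
      aeval (fun w : Fin n × Fin k => (X ((σ ∘ g) w.2, w.1) : MvPolynomial (Fin n × Fin n) ℂ)) Ψ := by
  rw [show ren σ (aeval (fun w : Fin n × Fin k => (X (g w.2, w.1) : MvPolynomial (Fin n × Fin n) ℂ)) Ψ) =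
    ((ren σ).comp (aeval fun w : Fin n × Fin k => (X (g w.2, w.1) : MvPolynomial (Fin n × Fin n) ℂ))) Ψ from rfl, comp_aeval]
  have hf : (fun w : Fin n × Fin k => (ren σ) (X (g w.2, w.1) : MvPolynomial (Fin n × Fin n) ℂ)) =
      (fun w : Fin n × Fin k => (X ((σ ∘ g) w.2, w.1) : MvPolynomial (Fin n × Fin n) ℂ)) ∘
        (fun w : Fin n × Fin k => (σ w.1, w.2)) := by
    funext w
    simp only [ren_X, Prod.smul_mk, Perm.smul_def, Function.comp_apply]
  rw [hf, ← aeval_rename, hΨ]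

/-- **ORBIT SUMS OF COLUMN-SYMMETRIC `k`-ROW PATTERNS ARE RESTORABLE.**  For every column-symmetric pattern
`Ψ ∈ ℂ[X_{(b,i)} : b < n, i < k]`, `Σ_{g : Fin k → Fin n} Ψ(x_{g(i) b})` is `QPOrbitRestorable (2k + 9) n`. [folklore] -/
theorem qpOrbitRestorable_orbitSum_colSymmetric (k : ℕ) (Ψ : MvPolynomial (Fin n × Fin k) ℂ)
    (hΨ : ∀ σ : Perm (Fin n), rename (fun w : Fin n × Fin k => (σ w.1, w.2)) Ψ = Ψ) :
    QPOrbitRestorable (2 * k + 9) n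
      (∑ g : Fin k → Fin n, aeval (fun w : Fin n × Fin k => (X (g w.2, w.1) : MvPolynomial (Fin n × Fin n) ℂ)) Ψ) :=
  qpOrbitRestorable_orbitSum _ (fun g => aeval_mem_adjoin_multiRowPowerSums g Ψ hΨ) (fun σ g => ren_aeval_pattern Ψ hΨ σ g)

/-! ### Sums over injective maps (`k` distinct rows) -/

/-- **ORBIT SUMS OVER INJECTIVE MAPS.**  If `Φ g ∈ ℂ[P_α(g) : α]` for every `g : Fin k → Fin n`, equivariantly, then the sum over the
INJECTIVE `g` only, `Σ_{g : Fin k ↪ Fin n} Φ g`, is `QPOrbitRestorable (2k + 9) n` as well. [folklore] -/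
theorem qpOrbitRestorable_orbitSum_injective {k : ℕ} (Φ : (Fin k → Fin n) → MvPolynomial (Fin n × Fin n) ℂ)
    (hmem : ∀ g, Φ g ∈ Algebra.adjoin ℂ (Set.range fun α : Fin k → ℕ =>
      ∑ b : Fin n, ∏ i : Fin k, (X (g i, b) : MvPolynomial (Fin n × Fin n) ℂ) ^ α i))
    (heq : ∀ (σ : Perm (Fin n)) (g : Fin k → Fin n), ren σ (Φ g) = Φ (σ ∘ g)) :
    QPOrbitRestorable (2 * k + 9) n (∑ g : (Fin k ↪ Fin n), Φ g) := by
  have hfix : ∀ σ : Perm (Fin n), ren σ (∑ g : (Fin k ↪ Fin n), Φ g) = ∑ g : (Fin k ↪ Fin n), Φ g := by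
    intro σ
    rw [map_sum]
    simp only [heq]
    refine Fintype.sum_equiv (Equiv.embeddingCongr (Equiv.refl (Fin k)) (σ : Fin n ≃ Fin n))
      (fun g : Fin k ↪ Fin n => Φ (σ ∘ g)) (fun g => Φ g) fun g => ?_
    congr 1
  have hsupp : ∀ g ∈ (Finset.univ : Finset (Fin k ↪ Fin n)), ∃ 𝒟 : ValueDerivation ℂ (Fin n × Fin n), Φ g ∈ 𝒟.S ∧
      ∀ q ∈ 𝒟.S, ∃ T' : Finset (Fin n), T'.card ≤ k + 2 ∧ ∀ σ : Perm (Fin n), (∀ i ∈ T', σ i = i) → ren σ q = q :=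
    fun g _ => (supported_of_mem_adjoin_multiRowPowerSums (g : Fin k → Fin n) (hmem g)).2
  obtain ⟨𝒟, hmemD, hS⟩ := exists_supported_sum (k := k + 2) Finset.univ (fun g : Fin k ↪ Fin n => Φ g) hsupp ∅ (by simp)
    (fun σ _ => hfix σ)
  obtain ⟨G, inst, C, hC, hev, horb⟩ := ValueOrbit.qpOrbit_of_supportedDerivation 𝒟 hmemD hfix hS
  refine ⟨G, inst, C, hC, hev, horb.trans ?_⟩
  have h1 : (n + 1) ^ (2 * (k + 2) + 4) = (n + 1) ^ (2 * k + 8) := by ring_nf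
  have h2 := succ_pow_le_bound n (2 * k + 8)
  have h3 : 2 * k + 8 + 1 = 2 * k + 9 := by omega
  rw [h3] at h2
  rw [h1]
  exact h2

/-- **The pattern instance over injective maps**: `Σ_{g : Fin k ↪ Fin n} Ψ(x_{g(i) b})` is `QPOrbitRestorable (2k + 9) n` for every
column-symmetric pattern `Ψ`. [folklore] -/
theorem qpOrbitRestorable_orbitSum_colSymmetric_injective (k : ℕ) (Ψ : MvPolynomial (Fin n × Fin k) ℂ)
    (hΨ : ∀ σ : Perm (Fin n), rename (fun w : Fin n × Fin k => (σ w.1, w.2)) Ψ = Ψ) :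
    QPOrbitRestorable (2 * k + 9) n
      (∑ g : (Fin k ↪ Fin n), aeval (fun w : Fin n × Fin k => (X (g w.2, w.1) : MvPolynomial (Fin n × Fin n) ℂ)) Ψ) :=
  qpOrbitRestorable_orbitSum_injective
    (fun g => aeval (fun w : Fin n × Fin k => (X (g w.2, w.1) : MvPolynomial (Fin n × Fin n) ℂ)) Ψ)
    (fun g => aeval_mem_adjoin_multiRowPowerSums g Ψ hΨ) (fun σ g => ren_aeval_pattern Ψ hΨ σ g)

end Summit.ValiantsHypothesis.ValiantsHypothesis.Theorems.MultiRowColumnProducts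

end
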